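import Literature.Computability.QuantumComplexity.IdleBlockInvariance
import Literature.Computability.QuantumComplexity.LightCone
import HarnessLib

/-!
# Gates on idle wires do not change the measured law off those wires

Topic `Literature/Computability/QuantumComplexity`; sequel of `IdleBlockInvariance.lean`
(`bornPMF_placeGate_map_eq`: one unitary placed on a block) and `LightCone.lean` (`SupportedOn`,
`SupportedOn.comm_toMatrix`: gates on disjoint wires commute). For a set `T` of **idle wires** — wires an
observable `f` of the measured register does not read — and a unitary gate set:

* `bornPMF_gate_map_eq`, `bornPMF_gates_map_eq` — gates (gate lists) acting inside `T` do not change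
  `(bornPMF ·).map f` of a unit vector;
* `toMatrix_eq_filter_mul` — if every gate of a circuit acts either inside `T` or off `T`, the circuit's
  matrix is (the gates inside `T`) ∘ (the gates off `T`): the idle gates commute to the end
  (Nielsen–Chuang 2010, eq. (2.45));
* **`bornPMF_toMatrix_map_eq_filter`** — hence the measured law along `f` is that of the circuit with
  the idle gates deleted.

In Regev's one-copy sampler (J. ACM 56 (2009), art. 34, Lemma 3.14) the uniform circuit at input length
`m` carries coordinate registers for up to `m` coordinates; the registers beyond the instance's
dimension are idle for the decoder, so the stages acting on them may be deleted in the analysis.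

Everything is proved; no definition, no named fact is introduced.

## References

* M. A. Nielsen, I. L. Chuang, *Quantum Computation and Quantum Information*, CUP 2010, §2.1.7
  eq. (2.45), §2.2.8, §4.2 [NielsenChuang2010].
* E. Bernstein, U. Vazirani, *Quantum complexity theory*, SIAM J. Comput. 26 (1997) 1411–1473, §8.2
  [BernsteinVazirani1997].
* O. Regev, *On lattices, learning with errors, random linear codes, and cryptography*, J. ACM 56
  (2009), art. 34, Lemma 3.14 (proof) [Regev2009].
-/

noncomputable section

open Matrix Finset

namespace Literature.Computability.QuantumComplexity

open Cryptography LightCone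

variable {G : QGateSet} {W : ℕ}

/-- **One gate inside the idle set** does not change the measured law off it.
[cite: NielsenChuang2010, §2.2.8, §4.2] -/
theorem bornPMF_gate_map_eq (hG : G.IsUnitary) (A : Language Bool) (g : QGate G W) {T : Finset (Fin W)}
    (hg : g.wires ⊆ T) {ψ : QReg W → ℂ} (hψ : normSq ψ = 1) {β : Type*} (f : QReg W → β)
    (hf : ∀ z z' : QReg W, (∀ w, w ∉ T → z w = z' w) → f z = f z') :
    (bornPMF (g.toMatrix A *ᵥ ψ)).map f = (bornPMF ψ).map f := by
  cases g with
  | gate g e =>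
    rw [QGate.toMatrix_gate]
    exact bornPMF_placeGate_map_eq e (hG g) hψ f fun z z' ha => hf z z' fun w hw =>
      ha w fun ⟨j, hj⟩ => hw (hg ((mem_wires_gate_iff g e w).2 ⟨j, hj⟩))
  | oracle k e =>
    rw [QGate.toMatrix_oracle]
    exact bornPMF_placeGate_map_eq e (oracleGate_mem_unitaryGroup_holds A k) hψ f fun z z' ha => hf z z' fun w hw =>
      ha w fun ⟨j, hj⟩ => hw (hg ((mem_wires_oracle_iff k e w).2 ⟨j, hj⟩))

/-- **Gates inside the idle set** do not change the measured law off it. [cite: NielsenChuang2010, §2.2.8, §4.2] -/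
theorem bornPMF_gates_map_eq (hG : G.IsUnitary) (A : Language Bool) {T : Finset (Fin W)} {β : Type*} (f : QReg W → β)
    (hf : ∀ z z' : QReg W, (∀ w, w ∉ T → z w = z' w) → f z = f z') :
    ∀ {gs : List (QGate G W)}, (∀ g ∈ gs, g.wires ⊆ T) → ∀ {ψ : QReg W → ℂ}, normSq ψ = 1 →
      (bornPMF ((⟨gs⟩ : QCircuit G W).toMatrix A *ᵥ ψ)).map f = (bornPMF ψ).map f
  | [], _, ψ, _ => by rw [QCircuit.toMatrix_nil, Matrix.one_mulVec]
  | g :: gs, h, ψ, hψ => by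
    rw [QCircuit.toMatrix_cons, ← Matrix.mulVec_mulVec]
    have hψ' : normSq (g.toMatrix A *ᵥ ψ) = 1 := by
      rw [normSq_mulVec_of_mem_unitaryGroup (QGate.toMatrix_mem_unitaryGroup_holds hG A g), hψ]
    rw [bornPMF_gates_map_eq hG A f hf (fun g' hg' => h g' (List.mem_cons_of_mem g hg')) hψ']
    exact bornPMF_gate_map_eq hG A g (h g List.mem_cons_self) hψ f hf

/-- **Idle gates commute to the end**: if every gate acts inside `T` (`p g = true`) or off `T`
(`p g = false`), the circuit's matrix is the idle part after the rest. [cite: NielsenChuang2010, §2.1.7 eq. (2.45), §4.2] -/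
theorem toMatrix_eq_filter_mul (A : Language Bool) {T : Finset (Fin W)} (p : QGate G W → Bool) :
    ∀ {gs : List (QGate G W)}, (∀ g ∈ gs, p g = true → g.wires ⊆ T) → (∀ g ∈ gs, p g = false → Disjoint g.wires T) →
      (⟨gs⟩ : QCircuit G W).toMatrix A =
        (⟨gs.filter p⟩ : QCircuit G W).toMatrix A * (⟨gs.filter fun g => !p g⟩ : QCircuit G W).toMatrix A
  | [], _, _ => by simp
  | g :: gs, hT, hD => by
    have ih := toMatrix_eq_filter_mul A p (gs := gs) (fun g' hg' => hT g' (List.mem_cons_of_mem g hg'))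
      (fun g' hg' => hD g' (List.mem_cons_of_mem g hg'))
    cases hp : p g with
    | true =>
      have e1 : (g :: gs).filter p = g :: gs.filter p := by simp [hp]
      have e2 : ((g :: gs).filter fun g => !p g) = gs.filter fun g => !p g := by simp [hp]
      have hN : SupportedOn Tᶜ ((⟨gs.filter fun g => !p g⟩ : QCircuit G W).toMatrix A) :=
        supportedOn_toMatrix_circuit A fun g' hg' => by
          have hm := List.mem_filter.1 hg'
          intro w hw
          rw [Finset.mem_compl]
          exact Finset.disjoint_left.1 (hD g' (List.mem_cons_of_mem g hm.1) (by simpa using hm.2)) hw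
      have hcomm := hN.comm_toMatrix A (g := g)
        (Finset.disjoint_left.2 fun w hw hwc => (Finset.mem_compl.1 hwc) (hT g List.mem_cons_self hp hw))
      rw [e1, e2, QCircuit.toMatrix_cons, QCircuit.toMatrix_cons, ih, Matrix.mul_assoc, hcomm, ← Matrix.mul_assoc]
    | false =>
      have e1 : (g :: gs).filter p = gs.filter p := by simp [hp]
      have e2 : ((g :: gs).filter fun g => !p g) = g :: gs.filter fun g => !p g := by simp [hp]
      rw [e1, e2, QCircuit.toMatrix_cons, QCircuit.toMatrix_cons, ih, Matrix.mul_assoc]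

/-- **Deleting the idle gates**: for a unitary gate set, a unit vector, an observable `f` not reading `T`
and a circuit all of whose gates act inside or off `T`, the measured law along `f` is that of the circuit
with the gates inside `T` deleted. [cite: NielsenChuang2010, §2.2.8, §4.2] [cite: Regev2009, Lemma 3.14 (proof)] -/
theorem bornPMF_toMatrix_map_eq_filter (hG : G.IsUnitary) (A : Language Bool) {T : Finset (Fin W)}
    (p : QGate G W → Bool) {gs : List (QGate G W)} (hT : ∀ g ∈ gs, p g = true → g.wires ⊆ T)
    (hD : ∀ g ∈ gs, p g = false → Disjoint g.wires T) {ψ : QReg W → ℂ} (hψ : normSq ψ = 1) {β : Type*}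
    (f : QReg W → β) (hf : ∀ z z' : QReg W, (∀ w, w ∉ T → z w = z' w) → f z = f z') :
    (bornPMF ((⟨gs⟩ : QCircuit G W).toMatrix A *ᵥ ψ)).map f =
      (bornPMF ((⟨gs.filter fun g => !p g⟩ : QCircuit G W).toMatrix A *ᵥ ψ)).map f := by
  rw [toMatrix_eq_filter_mul A p hT hD, ← Matrix.mulVec_mulVec]
  have hψ' : normSq ((⟨gs.filter fun g => !p g⟩ : QCircuit G W).toMatrix A *ᵥ ψ) = 1 := by
    rw [normSq_mulVec_of_mem_unitaryGroup (QCircuit.toMatrix_mem_unitaryGroup_holds hG A _), hψ]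
  exact bornPMF_gates_map_eq hG A f hf (fun g hg => hT g (List.mem_filter.1 hg).1 (List.mem_filter.1 hg).2) hψ'

end Literature.Computability.QuantumComplexity

end
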